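import Summits.CriticalPhenomena.PercolationContinuityZ3.Theorems.PercNearOneGluingNoHeavyLowerTailCILHyperedgeReduction
import HarnessLib

/-!
# `NoHeavyLowerTail` (stmt-CriticalPhenomena-4575) — the hyperedge inequality `DD ≥ 0` of the two-sided core from a TWO-ROW
# CERTIFICATE against a single comparison relay

Support file (prover `prim-hp-3`, hull-port line, submodularity / LP-duality seat; `--supports stmt-CriticalPhenomena-4575`).
No definitions, no named facts, no sorries.  Companion of `…CILHyperedgeReduction` (prover `prim-hp-2`), whose notation we keep:
`μ_w = prodBernoulli w` on `Fin n`, relays `A`, level `j`, `π(v) = {z ∈ A : v ↔ z}`, lightness `I_w(x) = μ_w{|π(x)| ≤ j}`, a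
two-port non-relay `s₂` (ports `c ≠ d`, coins `y_c, y_d`, `Y = y_c·y_d`), a second vertex `s₁`, a relay `i`, and the two OFF-`s₂` rows
(`'` = read on `ω ∩ {e | s₂ ∉ e}`, i.e. in the graph `w ∖ s₂`)

  `f_∅  = μ(i ↮' s₁, |π'(i)| ≤ j) − μ(i ↮' s₁, 1 ≤ |π'(s₁)| ≤ j)`,
  `f_cd = μ(i ↮' {s₁,c,d}, |π'(i)| ≤ j) − μ(i ↮' {s₁,c,d}, 1 ≤ |π'({s₁,c,d})| ≤ j)`,

so that `DD = (1 − Y)·f_∅ + Y·f_cd` is the hypothesis of `Theorems.Hyperedge.setCS_pair_of_hyperedgeDD` (the one open piece of the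
two-sided core with a two-port star at every level `j`; prim-hp-2 proved it for `j ≤ 2`).

* `Hyperedge.lightness_twoPort_expansion` — for a relay `x`: `I_w(x) = (1 − Y)·G_∅(x) + Y·G_cd(x)` with `G_∅(x) = μ(|π'(x)| ≤ j)` and
  `G_cd(x)` the off-`s₂` lightness of `x` with `c, d` GLUED (the star of a two-port vertex acts on relay clusters only by gluing its
  two ports, with probability `Y`; the computation inside `Hyperedge.lightness_eq_of_sameGlue`, exported).
* `Hyperedge.hyperedgeDD_of_twoRowCertificate` — **if for some relay `x` with `I_w(x) ≤ I_w(i)` and some `λ ≥ 0` the two ROW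
  inequalities `f_∅ ≥ λ·(G_∅(i) − G_∅(x))` and `f_cd ≥ λ·(G_cd(i) − G_cd(x))` hold, then `DD ≥ 0`**:
  `DD ≥ λ·[(1−Y)(G_∅(i) − G_∅(x)) + Y(G_cd(i) − G_cd(x))] = λ·(I_w(i) − I_w(x)) ≥ 0`.
* `Hyperedge.setCS_pair_of_twoRowCertificate` — the resulting form of the two-sided core: `CS_w({s₁,s₂}, i)` from `I_w(c), I_w(d),
  I_w(x) ≤ I_w(i)` and a two-row certificate against `x`.

Why this shape (crux notes of prim-hp-3 gen 2, HULLPORT-REF-gen2.md §3–§4; exact DP census + adversarial climbs, `n ≤ 7`): conditioning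
the two-sided kernel on the star of ONE of the two Steiner vertices makes it LINEAR in that star's law (0 LP-violations), so by Farkas a
row certificate with multipliers independent of the conditioned star exists; for a two-port star only the rows `∅` and `{c,d}` survive
prim-hp-2's peeling, and with `x` the port of `s₁` that is most often light in `w ∖ s₁ ∖ s₂` (when it dominates `c, d` there) a single
multiplier `λ ∈ [0, ∞)` serving both rows exists in every censused instance for EVERY relay `i` (conjecture "(dd-x)"; 0 / 1 266 exact +
90 climbs), whereas `λ = 0` (both rows nonnegative) and `λ = 1` are each refuted.  The row `∅` alone is classical: `f_∅ ≥ G_∅(i) − G_∅(x)`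
whenever `x` is a valid CIL witness for `s₁` in `w ∖ s₂` (`Theorems.cil_relayNeighbours_port`).
-/

noncomputable section

namespace Summit.CriticalPhenomena.PercolationContinuityZ3.Theorems

open MeasureTheory Set Literature.Probability.LatticeModels Literature.Probability.Percolation
open scoped Classical BigOperators

variable {n : ℕ}

namespace Hyperedge

open CutObserver KNPreFKG

/-- **Two-port expansion of a relay's lightness.**  Let `o ∉ A` have positive-weight pairs only to `c ≠ d` (both `≠ o`), `Y = w(oc)·w(od)`,
and let `x ∈ A`.  Then `I_w(x) = (1 − Y)·μ{|π'(x)| ≤ j} + Y·μ{|π'_{cd}(x)| ≤ j}`, where `'` reads a configuration off `o` and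
`π'_{cd}(x)` counts the relays joined off `o` to `x`, or to `{c,d}` while `x` is joined off `o` to `{c,d}` (the ports glued).
[folklore; the "series law" computation of `Hyperedge.lightness_eq_of_sameGlue`] -/
theorem lightness_twoPort_expansion (w : Sym2 (Fin n) → unitInterval) (A : Finset (Fin n)) (o c d x : Fin n) (j : ℕ)
    (hoA : o ∉ A) (hxA : x ∈ A) (hco : c ≠ o) (hdo : d ≠ o) (hcd : c ≠ d)
    (hobs : ∀ y, y ≠ o → w s(o, y) ≠ 0 → y = c ∨ y = d) :
    (prodBernoulli w).real {ω : BondConfig (Fin n) | (A.filter fun z => ω ∈ openConn x z).card ≤ j} =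
      (1 - (w s(o, c) : ℝ) * w s(o, d)) *
          (prodBernoulli w).real {ω : BondConfig (Fin n) |
            (A.filter fun z => (openGraph (ω ∩ {e | o ∉ e})).Reachable x z).card ≤ j} +
        ((w s(o, c) : ℝ) * w s(o, d)) *
          (prodBernoulli w).real {ω : BondConfig (Fin n) |
            (A.filter fun z => (openGraph (ω ∩ {e | o ∉ e})).Reachable x z ∨
              ((∃ b ∈ ({c, d} : Finset (Fin n)), (openGraph (ω ∩ {e | o ∉ e})).Reachable b x) ∧
                ∃ b' ∈ ({c, d} : Finset (Fin n)), (openGraph (ω ∩ {e | o ∉ e})).Reachable b' z)).card ≤ j} := by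
  set P : Finset (Fin n) := {c, d} with hP
  have hoP : o ∉ P := by simp [hP, hco.symm, hdo.symm]
  have hobs' : ∀ y, y ≠ o → y ∉ P → w s(o, y) = 0 := by
    intro y hyo hyP
    by_contra h
    rcases hobs y hyo h with rfl | rfl <;> simp [hP] at hyP
  set g : Finset (Fin n) → BondConfig (Fin n) → Prop := fun B ξ =>
    (A.filter fun z => (openGraph ξ).Reachable x z ∨
      ((∃ b ∈ B, (openGraph ξ).Reachable b x) ∧ ∃ b' ∈ B, (openGraph ξ).Reachable b' z)).card ≤ j with hg
  -- the `B = ∅` factor is the plain off-`o` lightness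
  have h0 : {ω : BondConfig (Fin n) | g ∅ (ω ∩ {e | o ∉ e})} =
      {ω : BondConfig (Fin n) | (A.filter fun z => (openGraph (ω ∩ {e | o ∉ e})).Reachable x z).card ≤ j} := by
    ext ω
    simp only [mem_setOf_eq, hg]
    exact lightness_star_term_of_card_le_one A ∅ x j (by simp) _
  -- expand over the stars of `o` and keep only `B = ∅`-type factors and the `B = P` correction
  have key : (prodBernoulli w).real {ω : BondConfig (Fin n) | (A.filter fun z => ω ∈ openConn x z).card ≤ j} =
      (prodBernoulli w).real {ω | g ∅ (ω ∩ {e | o ∉ e})} +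
        (w s(o, c) : ℝ) * w s(o, d) * ((prodBernoulli w).real {ω | g P (ω ∩ {e | o ∉ e})} -
          (prodBernoulli w).real {ω | g ∅ (ω ∩ {e | o ∉ e})}) := by
    rw [lightness_star_expansion w A o x P j hoA hxA hoP hobs']
    have hsplit : ∀ B ∈ P.powerset, (prodBernoulli w).real (starEvent o (↑B : Set (Fin n))) *
        (prodBernoulli w).real {ω | g B (ω ∩ {e | o ∉ e})} =
        (prodBernoulli w).real (starEvent o (↑B : Set (Fin n))) * (prodBernoulli w).real {ω | g ∅ (ω ∩ {e | o ∉ e})} +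
        (prodBernoulli w).real (starEvent o (↑B : Set (Fin n))) *
          ((prodBernoulli w).real {ω | g B (ω ∩ {e | o ∉ e})} - (prodBernoulli w).real {ω | g ∅ (ω ∩ {e | o ∉ e})}) := by
      intro B _; ring
    rw [Finset.sum_congr rfl hsplit, Finset.sum_add_distrib, ← Finset.sum_mul]
    have hone : ∑ B ∈ P.powerset, (prodBernoulli w).real (starEvent o (↑B : Set (Fin n))) = 1 := by
      have h := real_eq_sum_inter_starEvent w P o hoP hobs' Set.univ
      simp only [Set.univ_inter, probReal_univ] at h
      exact h.symm
    rw [hone, one_mul]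
    congr 1
    rw [Finset.sum_eq_single P]
    · rw [(measureReal_starEvent_twoPort_cases w o c d hco hdo hcd hobs).2.2.2]
    · intro B hB hBP
      have hBsub : B ⊆ P := Finset.mem_powerset.1 hB
      have hcard : B.card ≤ 1 := by
        have hlt : B.card < P.card := Finset.card_lt_card ⟨hBsub, fun h => hBP (Finset.Subset.antisymm hBsub h)⟩
        have hP2 : P.card ≤ 2 := by rw [hP]; exact Finset.card_insert_le _ _  |>.trans (by simp)
        omega
      have hev : {ω : BondConfig (Fin n) | g B (ω ∩ {e | o ∉ e})} = {ω | g ∅ (ω ∩ {e | o ∉ e})} := by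
        ext ω
        simp only [mem_setOf_eq, hg]
        rw [lightness_star_term_of_card_le_one A B x j hcard, lightness_star_term_of_card_le_one A ∅ x j (by simp)]
      rw [hev, sub_self, mul_zero]
    · intro h; exact absurd (Finset.mem_powerset.2 (subset_refl P)) h
  have hP' : {ω : BondConfig (Fin n) | g P (ω ∩ {e | o ∉ e})} =
      {ω : BondConfig (Fin n) | (A.filter fun z => (openGraph (ω ∩ {e | o ∉ e})).Reachable x z ∨
        ((∃ b ∈ P, (openGraph (ω ∩ {e | o ∉ e})).Reachable b x) ∧
          ∃ b' ∈ P, (openGraph (ω ∩ {e | o ∉ e})).Reachable b' z)).card ≤ j} := by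
    ext ω; simp only [mem_setOf_eq, hg]
  rw [key, h0, hP']
  ring

/-- **`DD ≥ 0` from a two-row certificate.**  Setting of `Hyperedge.setCS_pair_of_hyperedgeDD`: `s₂ ∉ A` with positive-weight pairs
only to the relays `c ≠ d`, a relay `i`, and the off-`s₂` rows `f_∅`, `f_cd` (see the module docstring).  Let `x ∈ A` be a relay with
`I_w(x) ≤ I_w(i)` and `λ ≥ 0` a multiplier with
  `λ·(G_∅(i) − G_∅(x)) ≤ f_∅`  and  `λ·(G_cd(i) − G_cd(x)) ≤ f_cd`,
where `G_∅`, `G_cd` are the off-`s₂` lightnesses without / with `c,d` glued (`Hyperedge.lightness_twoPort_expansion`).  Then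
`DD = (1−Y)·f_∅ + Y·f_cd ≥ λ·(I_w(i) − I_w(x)) ≥ 0`. [this file] -/
theorem hyperedgeDD_of_twoRowCertificate (w : Sym2 (Fin n) → unitInterval) (A : Finset (Fin n)) (s₁ s₂ c d i x : Fin n)
    (j : ℕ) (hs₂A : s₂ ∉ A) (hcA : c ∈ A) (hdA : d ∈ A) (hcd : c ≠ d) (hiA : i ∈ A) (hxA : x ∈ A)
    (hobs : ∀ u, u ≠ s₂ → w s(s₂, u) ≠ 0 → u = c ∨ u = d) (lam : ℝ) (hlam : 0 ≤ lam)
    (hdomx : (prodBernoulli w).real {ω : BondConfig (Fin n) | (A.filter fun z => ω ∈ openConn x z).card ≤ j} ≤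
      (prodBernoulli w).real {ω : BondConfig (Fin n) | (A.filter fun z => ω ∈ openConn i z).card ≤ j})
    (hrow0 : lam *
        ((prodBernoulli w).real {ω : BondConfig (Fin n) |
            (A.filter fun z => (openGraph (ω ∩ {e | s₂ ∉ e})).Reachable i z).card ≤ j} -
          (prodBernoulli w).real {ω : BondConfig (Fin n) |
            (A.filter fun z => (openGraph (ω ∩ {e | s₂ ∉ e})).Reachable x z).card ≤ j}) ≤
      (prodBernoulli w).real {ω : BondConfig (Fin n) |
          (∀ y ∈ ({s₁} : Finset (Fin n)), ¬ (openGraph (ω ∩ {e | s₂ ∉ e})).Reachable i y) ∧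
            (A.filter fun z => (openGraph (ω ∩ {e | s₂ ∉ e})).Reachable i z).card ≤ j} -
        (prodBernoulli w).real {ω : BondConfig (Fin n) |
          (∀ y ∈ ({s₁} : Finset (Fin n)), ¬ (openGraph (ω ∩ {e | s₂ ∉ e})).Reachable i y) ∧
            1 ≤ (A.filter fun z => ∃ y ∈ ({s₁} : Finset (Fin n)), (openGraph (ω ∩ {e | s₂ ∉ e})).Reachable y z).card ∧
            (A.filter fun z => ∃ y ∈ ({s₁} : Finset (Fin n)), (openGraph (ω ∩ {e | s₂ ∉ e})).Reachable y z).card ≤ j})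
    (hrow1 : lam *
        ((prodBernoulli w).real {ω : BondConfig (Fin n) |
            (A.filter fun z => (openGraph (ω ∩ {e | s₂ ∉ e})).Reachable i z ∨
              ((∃ b ∈ ({c, d} : Finset (Fin n)), (openGraph (ω ∩ {e | s₂ ∉ e})).Reachable b i) ∧
                ∃ b' ∈ ({c, d} : Finset (Fin n)), (openGraph (ω ∩ {e | s₂ ∉ e})).Reachable b' z)).card ≤ j} -
          (prodBernoulli w).real {ω : BondConfig (Fin n) |
            (A.filter fun z => (openGraph (ω ∩ {e | s₂ ∉ e})).Reachable x z ∨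
              ((∃ b ∈ ({c, d} : Finset (Fin n)), (openGraph (ω ∩ {e | s₂ ∉ e})).Reachable b x) ∧
                ∃ b' ∈ ({c, d} : Finset (Fin n)), (openGraph (ω ∩ {e | s₂ ∉ e})).Reachable b' z)).card ≤ j}) ≤
      (prodBernoulli w).real {ω : BondConfig (Fin n) |
          (∀ y ∈ ({s₁} ∪ {c, d} : Finset (Fin n)), ¬ (openGraph (ω ∩ {e | s₂ ∉ e})).Reachable i y) ∧
            (A.filter fun z => (openGraph (ω ∩ {e | s₂ ∉ e})).Reachable i z).card ≤ j} -
        (prodBernoulli w).real {ω : BondConfig (Fin n) |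
          (∀ y ∈ ({s₁} ∪ {c, d} : Finset (Fin n)), ¬ (openGraph (ω ∩ {e | s₂ ∉ e})).Reachable i y) ∧
            1 ≤ (A.filter fun z => ∃ y ∈ ({s₁} ∪ {c, d} : Finset (Fin n)), (openGraph (ω ∩ {e | s₂ ∉ e})).Reachable y z).card ∧
            (A.filter fun z => ∃ y ∈ ({s₁} ∪ {c, d} : Finset (Fin n)),
              (openGraph (ω ∩ {e | s₂ ∉ e})).Reachable y z).card ≤ j}) :
    0 ≤ (1 - (w s(s₂, c) : ℝ) * w s(s₂, d)) *
        ((prodBernoulli w).real {ω : BondConfig (Fin n) |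
            (∀ y ∈ ({s₁} : Finset (Fin n)), ¬ (openGraph (ω ∩ {e | s₂ ∉ e})).Reachable i y) ∧
              (A.filter fun z => (openGraph (ω ∩ {e | s₂ ∉ e})).Reachable i z).card ≤ j} -
          (prodBernoulli w).real {ω : BondConfig (Fin n) |
            (∀ y ∈ ({s₁} : Finset (Fin n)), ¬ (openGraph (ω ∩ {e | s₂ ∉ e})).Reachable i y) ∧
              1 ≤ (A.filter fun z => ∃ y ∈ ({s₁} : Finset (Fin n)), (openGraph (ω ∩ {e | s₂ ∉ e})).Reachable y z).card ∧
              (A.filter fun z => ∃ y ∈ ({s₁} : Finset (Fin n)), (openGraph (ω ∩ {e | s₂ ∉ e})).Reachable y z).card ≤ j}) +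
      ((w s(s₂, c) : ℝ) * w s(s₂, d)) *
        ((prodBernoulli w).real {ω : BondConfig (Fin n) |
            (∀ y ∈ ({s₁} ∪ {c, d} : Finset (Fin n)), ¬ (openGraph (ω ∩ {e | s₂ ∉ e})).Reachable i y) ∧
              (A.filter fun z => (openGraph (ω ∩ {e | s₂ ∉ e})).Reachable i z).card ≤ j} -
          (prodBernoulli w).real {ω : BondConfig (Fin n) |
            (∀ y ∈ ({s₁} ∪ {c, d} : Finset (Fin n)), ¬ (openGraph (ω ∩ {e | s₂ ∉ e})).Reachable i y) ∧
              1 ≤ (A.filter fun z => ∃ y ∈ ({s₁} ∪ {c, d} : Finset (Fin n)), (openGraph (ω ∩ {e | s₂ ∉ e})).Reachable y z).card ∧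
              (A.filter fun z => ∃ y ∈ ({s₁} ∪ {c, d} : Finset (Fin n)),
                (openGraph (ω ∩ {e | s₂ ∉ e})).Reachable y z).card ≤ j}) := by
  have hcs : c ≠ s₂ := fun h => hs₂A (h ▸ hcA)
  have hds : d ≠ s₂ := fun h => hs₂A (h ▸ hdA)
  have hY0 : 0 ≤ (w s(s₂, c) : ℝ) * w s(s₂, d) := mul_nonneg (w s(s₂, c)).2.1 (w s(s₂, d)).2.1
  have hY1 : (w s(s₂, c) : ℝ) * w s(s₂, d) ≤ 1 := (unitInterval.mul_mem (w s(s₂, c)).2 (w s(s₂, d)).2).2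
  -- the two-port expansions of `I_w(i)` and `I_w(x)` (stated before the abbreviations so that `set` rewrites them)
  have ei := lightness_twoPort_expansion w A s₂ c d i j hs₂A hiA hcs hds hcd hobs
  have ex := lightness_twoPort_expansion w A s₂ c d x j hs₂A hxA hcs hds hcd hobs
  -- abbreviations
  set Y : ℝ := (w s(s₂, c) : ℝ) * w s(s₂, d) with hY
  set G0i := (prodBernoulli w).real {ω : BondConfig (Fin n) |
      (A.filter fun z => (openGraph (ω ∩ {e | s₂ ∉ e})).Reachable i z).card ≤ j} with hG0i
  set G0x := (prodBernoulli w).real {ω : BondConfig (Fin n) |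
      (A.filter fun z => (openGraph (ω ∩ {e | s₂ ∉ e})).Reachable x z).card ≤ j} with hG0x
  set G1i := (prodBernoulli w).real {ω : BondConfig (Fin n) |
      (A.filter fun z => (openGraph (ω ∩ {e | s₂ ∉ e})).Reachable i z ∨
        ((∃ b ∈ ({c, d} : Finset (Fin n)), (openGraph (ω ∩ {e | s₂ ∉ e})).Reachable b i) ∧
          ∃ b' ∈ ({c, d} : Finset (Fin n)), (openGraph (ω ∩ {e | s₂ ∉ e})).Reachable b' z)).card ≤ j} with hG1i
  set G1x := (prodBernoulli w).real {ω : BondConfig (Fin n) |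
      (A.filter fun z => (openGraph (ω ∩ {e | s₂ ∉ e})).Reachable x z ∨
        ((∃ b ∈ ({c, d} : Finset (Fin n)), (openGraph (ω ∩ {e | s₂ ∉ e})).Reachable b x) ∧
          ∃ b' ∈ ({c, d} : Finset (Fin n)), (openGraph (ω ∩ {e | s₂ ∉ e})).Reachable b' z)).card ≤ j} with hG1x
  set f0 := (prodBernoulli w).real {ω : BondConfig (Fin n) |
        (∀ y ∈ ({s₁} : Finset (Fin n)), ¬ (openGraph (ω ∩ {e | s₂ ∉ e})).Reachable i y) ∧
          (A.filter fun z => (openGraph (ω ∩ {e | s₂ ∉ e})).Reachable i z).card ≤ j} -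
      (prodBernoulli w).real {ω : BondConfig (Fin n) |
        (∀ y ∈ ({s₁} : Finset (Fin n)), ¬ (openGraph (ω ∩ {e | s₂ ∉ e})).Reachable i y) ∧
          1 ≤ (A.filter fun z => ∃ y ∈ ({s₁} : Finset (Fin n)), (openGraph (ω ∩ {e | s₂ ∉ e})).Reachable y z).card ∧
          (A.filter fun z => ∃ y ∈ ({s₁} : Finset (Fin n)), (openGraph (ω ∩ {e | s₂ ∉ e})).Reachable y z).card ≤ j}
    with hf0
  set f1 := (prodBernoulli w).real {ω : BondConfig (Fin n) |
        (∀ y ∈ ({s₁} ∪ {c, d} : Finset (Fin n)), ¬ (openGraph (ω ∩ {e | s₂ ∉ e})).Reachable i y) ∧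
          (A.filter fun z => (openGraph (ω ∩ {e | s₂ ∉ e})).Reachable i z).card ≤ j} -
      (prodBernoulli w).real {ω : BondConfig (Fin n) |
        (∀ y ∈ ({s₁} ∪ {c, d} : Finset (Fin n)), ¬ (openGraph (ω ∩ {e | s₂ ∉ e})).Reachable i y) ∧
          1 ≤ (A.filter fun z => ∃ y ∈ ({s₁} ∪ {c, d} : Finset (Fin n)), (openGraph (ω ∩ {e | s₂ ∉ e})).Reachable y z).card ∧
          (A.filter fun z => ∃ y ∈ ({s₁} ∪ {c, d} : Finset (Fin n)),
            (openGraph (ω ∩ {e | s₂ ∉ e})).Reachable y z).card ≤ j}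
    with hf1
  have h1 : (1 - Y) * (lam * (G0i - G0x)) ≤ (1 - Y) * f0 := mul_le_mul_of_nonneg_left hrow0 (by linarith)
  have h2 : Y * (lam * (G1i - G1x)) ≤ Y * f1 := mul_le_mul_of_nonneg_left hrow1 hY0
  have h3 : 0 ≤ lam * ((prodBernoulli w).real {ω : BondConfig (Fin n) | (A.filter fun z => ω ∈ openConn i z).card ≤ j} -
      (prodBernoulli w).real {ω : BondConfig (Fin n) | (A.filter fun z => ω ∈ openConn x z).card ≤ j}) :=
    mul_nonneg hlam (by linarith)
  calc (0 : ℝ) ≤ lam * ((prodBernoulli w).real {ω : BondConfig (Fin n) | (A.filter fun z => ω ∈ openConn i z).card ≤ j} -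
        (prodBernoulli w).real {ω : BondConfig (Fin n) | (A.filter fun z => ω ∈ openConn x z).card ≤ j}) := h3
    _ = (1 - Y) * (lam * (G0i - G0x)) + Y * (lam * (G1i - G1x)) := by rw [ei, ex]; ring
    _ ≤ (1 - Y) * f0 + Y * f1 := add_le_add h1 h2

/-- **The two-sided core with a two-port star, from a two-row certificate.**  `s₁ ≠ s₂`, `s₂ ∉ A` with positive-weight pairs only to the
relays `c ≠ d`; a relay `i ≠ s₁` with `I_w(c), I_w(d) ≤ I_w(i)`; a comparison relay `x` with `I_w(x) ≤ I_w(i)`; a multiplier `λ ≥ 0` with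
the two row inequalities of `Hyperedge.hyperedgeDD_of_twoRowCertificate`.  Then `CS_w({s₁,s₂}, i)`:
`μ(i ↮ {s₁,s₂}, 1 ≤ |π({s₁,s₂})| ≤ j) ≤ μ(i ↮ {s₁,s₂}, |π(i)| ≤ j)`.  (`Hyperedge.setCS_pair_of_hyperedgeDD` with `DD ≥ 0` supplied by
the certificate.) [this file] -/
theorem setCS_pair_of_twoRowCertificate (w : Sym2 (Fin n) → unitInterval) (A : Finset (Fin n)) (s₁ s₂ c d i x : Fin n) (j : ℕ)
    (hs₂A : s₂ ∉ A) (h12 : s₁ ≠ s₂) (hcA : c ∈ A) (hdA : d ∈ A) (hcd : c ≠ d) (hiA : i ∈ A) (hi1 : i ≠ s₁) (hxA : x ∈ A)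
    (hobs : ∀ u, u ≠ s₂ → w s(s₂, u) ≠ 0 → u = c ∨ u = d)
    (hdomc : (prodBernoulli w).real {ω : BondConfig (Fin n) | (A.filter fun z => ω ∈ openConn c z).card ≤ j} ≤
      (prodBernoulli w).real {ω : BondConfig (Fin n) | (A.filter fun z => ω ∈ openConn i z).card ≤ j})
    (hdomd : (prodBernoulli w).real {ω : BondConfig (Fin n) | (A.filter fun z => ω ∈ openConn d z).card ≤ j} ≤
      (prodBernoulli w).real {ω : BondConfig (Fin n) | (A.filter fun z => ω ∈ openConn i z).card ≤ j})
    (lam : ℝ) (hlam : 0 ≤ lam)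
    (hdomx : (prodBernoulli w).real {ω : BondConfig (Fin n) | (A.filter fun z => ω ∈ openConn x z).card ≤ j} ≤
      (prodBernoulli w).real {ω : BondConfig (Fin n) | (A.filter fun z => ω ∈ openConn i z).card ≤ j})
    (hrow0 : lam *
        ((prodBernoulli w).real {ω : BondConfig (Fin n) |
            (A.filter fun z => (openGraph (ω ∩ {e | s₂ ∉ e})).Reachable i z).card ≤ j} -
          (prodBernoulli w).real {ω : BondConfig (Fin n) |
            (A.filter fun z => (openGraph (ω ∩ {e | s₂ ∉ e})).Reachable x z).card ≤ j}) ≤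
      (prodBernoulli w).real {ω : BondConfig (Fin n) |
          (∀ y ∈ ({s₁} : Finset (Fin n)), ¬ (openGraph (ω ∩ {e | s₂ ∉ e})).Reachable i y) ∧
            (A.filter fun z => (openGraph (ω ∩ {e | s₂ ∉ e})).Reachable i z).card ≤ j} -
        (prodBernoulli w).real {ω : BondConfig (Fin n) |
          (∀ y ∈ ({s₁} : Finset (Fin n)), ¬ (openGraph (ω ∩ {e | s₂ ∉ e})).Reachable i y) ∧
            1 ≤ (A.filter fun z => ∃ y ∈ ({s₁} : Finset (Fin n)), (openGraph (ω ∩ {e | s₂ ∉ e})).Reachable y z).card ∧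
            (A.filter fun z => ∃ y ∈ ({s₁} : Finset (Fin n)), (openGraph (ω ∩ {e | s₂ ∉ e})).Reachable y z).card ≤ j})
    (hrow1 : lam *
        ((prodBernoulli w).real {ω : BondConfig (Fin n) |
            (A.filter fun z => (openGraph (ω ∩ {e | s₂ ∉ e})).Reachable i z ∨
              ((∃ b ∈ ({c, d} : Finset (Fin n)), (openGraph (ω ∩ {e | s₂ ∉ e})).Reachable b i) ∧
                ∃ b' ∈ ({c, d} : Finset (Fin n)), (openGraph (ω ∩ {e | s₂ ∉ e})).Reachable b' z)).card ≤ j} -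
          (prodBernoulli w).real {ω : BondConfig (Fin n) |
            (A.filter fun z => (openGraph (ω ∩ {e | s₂ ∉ e})).Reachable x z ∨
              ((∃ b ∈ ({c, d} : Finset (Fin n)), (openGraph (ω ∩ {e | s₂ ∉ e})).Reachable b x) ∧
                ∃ b' ∈ ({c, d} : Finset (Fin n)), (openGraph (ω ∩ {e | s₂ ∉ e})).Reachable b' z)).card ≤ j}) ≤
      (prodBernoulli w).real {ω : BondConfig (Fin n) |
          (∀ y ∈ ({s₁} ∪ {c, d} : Finset (Fin n)), ¬ (openGraph (ω ∩ {e | s₂ ∉ e})).Reachable i y) ∧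
            (A.filter fun z => (openGraph (ω ∩ {e | s₂ ∉ e})).Reachable i z).card ≤ j} -
        (prodBernoulli w).real {ω : BondConfig (Fin n) |
          (∀ y ∈ ({s₁} ∪ {c, d} : Finset (Fin n)), ¬ (openGraph (ω ∩ {e | s₂ ∉ e})).Reachable i y) ∧
            1 ≤ (A.filter fun z => ∃ y ∈ ({s₁} ∪ {c, d} : Finset (Fin n)), (openGraph (ω ∩ {e | s₂ ∉ e})).Reachable y z).card ∧
            (A.filter fun z => ∃ y ∈ ({s₁} ∪ {c, d} : Finset (Fin n)),
              (openGraph (ω ∩ {e | s₂ ∉ e})).Reachable y z).card ≤ j}) :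
    (prodBernoulli w).real {ω : BondConfig (Fin n) | (∀ y ∈ ({s₁, s₂} : Finset (Fin n)), ω ∉ openConn i y) ∧
        1 ≤ (A.filter fun z => ∃ y ∈ ({s₁, s₂} : Finset (Fin n)), ω ∈ openConn y z).card ∧
        (A.filter fun z => ∃ y ∈ ({s₁, s₂} : Finset (Fin n)), ω ∈ openConn y z).card ≤ j} ≤
      (prodBernoulli w).real {ω : BondConfig (Fin n) | (∀ y ∈ ({s₁, s₂} : Finset (Fin n)), ω ∉ openConn i y) ∧
        (A.filter fun z => ω ∈ openConn i z).card ≤ j} :=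
  setCS_pair_of_hyperedgeDD w A s₁ s₂ c d i j hs₂A h12 hcA hdA hcd hiA hi1 hobs hdomc hdomd
    (hyperedgeDD_of_twoRowCertificate w A s₁ s₂ c d i x j hs₂A hcA hdA hcd hiA hxA hobs lam hlam hdomx hrow0 hrow1)

end Hyperedge

end Summit.CriticalPhenomena.PercolationContinuityZ3.Theorems

end
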